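import Summits.ResolutionOfSingularities.ResolutionOfSingularities.Theorems.MarkedTransferCampaignW31EdgePieceBridge
import Summits.ResolutionOfSingularities.ResolutionOfSingularities.Theorems.MarkedTransferCampaignW31HasseSymbol
import Summits.ResolutionOfSingularities.ResolutionOfSingularities.Theorems.MarkedTransferCampaignW31UscModuloHasseStable
import HarnessLib

/-!
# [OURS · L1 W3.1] Hasse–Schmidt stability of the edge algebra (`U19_4_R2`) FROM stalkwise Diff-closedness (`U19_3`) and a
# Leibniz family extending the Hasse derivatives — step (4) of the W3.1 route; the slot statement modulo `Thm4_1` + Leibniz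
# families (seat res-L1-s31-pv-3)

Cell `res-hironaka` (run/shared/lean/pub/res-hironaka/), rung L (rescue) of LADDER-RESOLUTION, slot W3.1 «u.s.c. first»
(positive rung, verdict-free). HOST (custody, no new route): the existing crux `Theses.MarkedTransfer.HypersurfaceOrderReduction`
stmt-ResolutionOfSingularities-16155, `--supports … --as helper`, as every W3.1 file. This is STEP (4) («the typed plumbing») of
res-L1-s31-pv-1's ROUTE-NOTE 2026-08-27T00:33:22Z for `U19_4_R2 ⇐ U19_3`; step (3) is pv-1's `MarkedTransferCampaignW31HasseSymbol`
(p479063: Leibniz families, their order, the symbol congruence), step (2) (EXISTENCE of a Leibniz family on `O_{Z,ξ}` extending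
the Hasse derivatives along the formally étale coordinate map) is in progress at pv-1 and enters here as a HYPOTHESIS.

HONEST FRAMING. OURS-side algebra / pure logic over OUR typed carriers and the tree's libraries; NOTHING here is a statement
of H. Hironaka's manuscript *Resolution of singularities in positive characteristics* (2017-03-23, [Hironaka2017]). Typed
candidates of the manuscript enter ONLY as hypotheses and are never asserted: `S04CharAlgebra.U19_3` (§4.1 (8) p.19 l.30–31
«`℘(E)_ξ` is Diff-closed by the nature of characteristic algebra», stalkwise) resp. `S04CharAlgebra.Thm4_1` (Th. 4.1 p.17
l.20–30, through the HIRONAKA-L lane's `U19_3_of`). No FACT-LIST fact is consumed. AI-produced; weaker than expert review.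

## What is proved (sorry-free; axioms ⊆ {propext, Classical.choice, Quot.sound})

Bookkeeping on the tree's `Resolution.hasseDeriv`: `map_hasseDeriv` (change of coefficients), `isHomogeneous_hasseDeriv`
(`∂^{(α)}` of a form of degree `d` is a form of degree `d − |α|`), `eq_C_of_isHomogeneous_zero`, `eval_hasseDeriv_monomial`,
`eval_hasseDeriv_eq_sum`, `eval_eq_sum_mul_aeval_monomial`.

Local (local `K`-algebra `(O, 𝔪, κ)`, `z` generating `𝔪`, graded family `A` — the shape of `d ↦ ℘(E,d)_ξ` — with its algebra
`⊕ A_d X^d` Diff-closed in the shape of the typed `U19_3`, and a Leibniz family `Δ` on `O` with `Δ_0 = id` extending the Hasse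
derivatives along `aeval z`):
* `hasseDeriv_mem_of_isHomogeneous_of_leibnizFamily` — a FORM `F` of degree `d` in the `κ`-subalgebra `U` with carrier
  `edgeG (⊕ A_d X^d) z` has every `∂^{(β)} F` in `U`: for `|β| ≥ d` it is a constant; for `|β| < d`, lift `F` to a form `G`
  over `O`, split `G(z) = y + w` (`y X^d ∈ ⊕ A_d X^d`, `w ∈ 𝔪^{d+1}`: membership criterion, p477733), use
  `Δ_β ∈ Diff^{≤|β|}` (p479063) and Diff-closedness to get `Δ_β y ∈ A_{d−|β|}`, and identify `ν((Δ_β y) X^{d−|β|})` with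
  `polyMap (∂^{(β)} F)` through the symbol congruence (p479063) and `∂^{(β)} F = (∂^{(β)} G)‾`.
* `hasseDeriv_mem_edgeG_of_leibnizFamily` — hence `edgeG (⊕ A_d X^d) z` is stable under every `∂^{(β)}` (gradedness, p477733).
Scheme level:
* **`U19_4_R2_of_U19_3_of_leibnizFamily`** : `U19_3 p f E` + (Leibniz families at the closed singular points for every r.s.p.)
  ⇒ `U19_4_R2 p f E`.
* **`campaignW31UscInvOneExponentI_of_U19_3_of_leibnizFamily`**, **`campaignW31UscInvOneExponentI_of_Thm4_1_of_leibnizFamily`** —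
  THE SLOT STATEMENT `CampaignW31UscInvOneExponentI p` (u.s.c. of `ξ ↦ Inv_ξ(E)` on `Sing(E)_cl` for one standard `E`, every
  selection of Def. 4.9 edge data) modulo `U19_3` (resp. `Thm4_1`) and the existence of Leibniz families (via p479154).

## What remains

Step (2): the existence of a Leibniz family on `O_{Z,ξ}` extending the Hasse derivatives along `aeval z` for an r.s.p. `z` at a
closed point of the smooth `Z` over the perfect `K` (formal étaleness of `K[X] → O_{Z,ξ}`; res-L1-s31-pv-1), and the discharge of
`Thm4_1` (2) for the geometric `℘` (HIRONAKA-L lane: Diff theorem F-20a + the `SIncl`/`Incl` bridge).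

## References (context only; nothing below is a premise)

* H. Hironaka, ms. 2017-03-23, Th. 4.1 p.17 l.20–30; §4.1 (8) p.19 l.27–32 — scope only, under adjudication. [Hironaka2017]
* A. Grothendieck, EGA IV₄ (Publ. IHÉS 32, 1967), §16.8 (differential operators), Thm. 16.11.2 (Hasse–Schmidt basis). [EGAIV4]
-/

noncomputable section

set_option linter.dupNamespace false -- mandated namespace of this single-conjunct summit

open scoped Polynomial
open IsLocalRing MvPolynomial
-- `Finset.antidiagonal` alone resolves to the `Set.IsPWO` antidiagonal of `Data.Finset.MulAntidiagonal`
open Finset.HasAntidiagonal (antidiagonal)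

namespace Summit.ResolutionOfSingularities.ResolutionOfSingularities.Theorems

open _root_.AlgebraicGeometry
open Literature.AlgebraicGeometry.Resolution
open Literature.AlgebraicGeometry.Hironaka2017
open Literature.AlgebraicGeometry.Hironaka2017.S02Preliminaries
open Literature.AlgebraicGeometry.Hironaka2017.S04CharAlgebra

universe u

namespace CampaignW31

/-! ## Hasse–Schmidt derivatives over a change of coefficients; on forms -/

section HasseBookkeeping

variable {R S : Type*} [CommRing R] [CommRing S] {σ : Type*} [DecidableEq σ]

/-- The Hasse–Schmidt derivatives commute with a change of coefficient ring. [folklore] -/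
theorem map_hasseDeriv (f : R →+* S) (α : σ →₀ ℕ) (G : MvPolynomial σ R) :
    MvPolynomial.map f (hasseDeriv R α G) = hasseDeriv S α (MvPolynomial.map f G) := by
  induction G using MvPolynomial.induction_on' with
  | monomial γ c =>
    rw [hasseDeriv_monomial, map_monomial, hasseDeriv_monomial, map_mul, map_monomial, map_natCast]
  | add p q hp hq => simp only [map_add, hp, hq]

/-- The Hasse–Schmidt derivative `D^{(α)}` of a form of degree `d` is a form of degree `d − |α|` (truncated; for
`|α| > d` it vanishes, which is also a form of that degree). [folklore] -/
theorem isHomogeneous_hasseDeriv {G : MvPolynomial σ R} {d : ℕ} (hG : G.IsHomogeneous d) (α : σ →₀ ℕ) :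
    (hasseDeriv R α G).IsHomogeneous (d - α.degree) := by
  rw [G.as_sum, map_sum]
  refine IsHomogeneous.sum _ _ _ fun γ hγ => ?_
  by_cases h : α ≤ γ
  · rw [hasseDeriv_monomial, ← map_natCast (C : R →+* MvPolynomial σ R), C_mul_monomial]
    refine isHomogeneous_monomial _ ?_
    have hdeg : γ.degree = d := degree_eq_of_mem_support hG hγ
    have e : (γ - α) + α = γ := tsub_add_cancel_of_le h
    have := congrArg Finsupp.degree e
    rw [map_add, hdeg] at this
    omega
  · rw [hasseDeriv_monomial_eq_zero_of_not_le _ h]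
    exact isHomogeneous_zero _ _ _

omit [DecidableEq σ] in
/-- A form of degree `0` is a constant. [folklore] -/
theorem eq_C_of_isHomogeneous_zero {G : MvPolynomial σ R} (hG : G.IsHomogeneous 0) : G = C (coeff 0 G) :=
  totalDegree_eq_zero_iff_eq_C.mp (Nat.le_zero.mp hG.totalDegree_le)

end HasseBookkeeping

/-! ## Evaluating Hasse derivatives of lifts at the parameters -/

section Eval

variable {K : Type u} [Field K] {O : Type u} [CommRing O] [Algebra K O] {n : ℕ} (z : Fin n → O)

/-- `(D^{(β)} (c X^γ))(z) = c · φ(D^{(β)} X^γ)` for the coordinate map `φ = aeval z : K[X] → O`. [folklore] -/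
theorem eval_hasseDeriv_monomial (β γ : Fin n →₀ ℕ) (c : O) :
    MvPolynomial.eval z (hasseDeriv O β (monomial γ c)) =
      c * MvPolynomial.aeval z (hasseDeriv K β (monomial γ (1 : K))) := by
  classical
  rw [hasseDeriv_monomial, hasseDeriv_monomial, map_mul, map_mul, map_natCast, map_natCast, eval_monomial,
    aeval_monomial, map_one, one_mul]
  ring

/-- `(D^{(β)} G)(z) = Σ_γ c_γ · φ(D^{(β)} X^γ)` over the support of `G = Σ_γ c_γ X^γ`. [folklore] -/
theorem eval_hasseDeriv_eq_sum (β : Fin n →₀ ℕ) (G : MvPolynomial (Fin n) O) :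
    MvPolynomial.eval z (hasseDeriv O β G) =
      ∑ γ ∈ G.support, G.coeff γ * MvPolynomial.aeval z (hasseDeriv K β (monomial γ (1 : K))) := by
  classical
  conv_lhs => rw [G.as_sum]
  rw [map_sum, map_sum]
  exact Finset.sum_congr rfl fun γ _ => eval_hasseDeriv_monomial z β γ (G.coeff γ)

/-- `G(z) = Σ_γ c_γ · φ(X^γ)`. [folklore] -/
theorem eval_eq_sum_mul_aeval_monomial (G : MvPolynomial (Fin n) O) :
    MvPolynomial.eval z G = ∑ γ ∈ G.support, G.coeff γ * MvPolynomial.aeval z (monomial γ (1 : K)) := by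
  classical
  conv_lhs => rw [G.as_sum]
  rw [map_sum]
  refine Finset.sum_congr rfl fun γ _ => ?_
  rw [eval_monomial, aeval_monomial, map_one, one_mul]

end Eval

/-! ## Hasse–Schmidt stability of `edgeG` from Diff-closedness of `⊕ A_d X^d` and a Leibniz family -/

section Local

variable {K : Type u} [Field K] {O : Type u} [CommRing O] [IsLocalRing O] [Algebra K O] {n : ℕ}
  (z : Fin n → O) (hz : Ideal.span (Set.range z) = maximalIdeal O)
  (A : ℕ → Ideal O) (h0 : A 0 = ⊤) (hmul : ∀ b c, A b * A c ≤ A (b + c))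
  (Δ : (Fin n →₀ ℕ) → (O →ₗ[K] O)) (hΔ0 : Δ 0 = LinearMap.id)
  (hΔmul : ∀ (β : Fin n →₀ ℕ) (x y : O), Δ β (x * y) = ∑ q ∈ antidiagonal β, Δ q.1 x * Δ q.2 y)
  (hΔext : ∀ (β : Fin n →₀ ℕ) (F : MvPolynomial (Fin n) K),
    Δ β (MvPolynomial.aeval z F) = MvPolynomial.aeval z (hasseDeriv K β F))
  (hdiff : ∀ (d m : ℕ), m < d → ∀ D : O →ₗ[K] O, D ∈ diffOp K O m →
    ∀ g : O, Polynomial.monomial d g ∈ familySubalgebra O A →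
      Polynomial.monomial (d - m) (D g) ∈ familySubalgebra O A)

include hz h0 hmul hΔ0 hΔmul hΔext hdiff in
/-- **Homogeneous case.** For `U ⊆ κ[Z]` the `κ`-subalgebra with carrier `edgeG (⊕ A_d X^d) z`, a FORM `F ∈ U` of degree `d`
has all its Hasse–Schmidt derivatives `∂^{(β)} F` in `U`: if `|β| ≥ d` the derivative is a constant; if `|β| < d`, lift `F`
to a form `G` over `O` with `ν(G(z) X^d) = polyMap F`, split `G(z) = y + w` with `y X^d ∈ ⊕ A_d X^d`, `w ∈ 𝔪^{d+1}`
(membership criterion), apply the Leibniz family member `Δ_β ∈ Diff^{≤|β|}` to `y` (Diff-closedness puts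
`Δ_β y ∈ A_{d−|β|}`), and compare with `(∂^{(β)} G)(z)` through the symbol congruence (res-L1-s31-pv-1's
`leibnizFamily_symbol_congr`): `∂^{(β)} F = (∂^{(β)} G)‾` lies in `U` by the criterion again. [folklore] -/
theorem hasseDeriv_mem_of_isHomogeneous_of_leibnizFamily
    {U : Subalgebra (ResidueField O) (MvPolynomial (Fin n) (ResidueField O))}
    (hU : (U : Set _) = edgeG (familySubalgebra O A) z hz) {F : MvPolynomial (Fin n) (ResidueField O)} {d : ℕ}
    (hFU : F ∈ U) (hFd : F.IsHomogeneous d) (β : Fin n →₀ ℕ) :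
    hasseDeriv (ResidueField O) β F ∈ U := by
  classical
  by_cases hmd : β.degree < d
  swap
  · -- `|β| ≥ d`: the derivative is a constant
    have h0deg : (hasseDeriv (ResidueField O) β F).IsHomogeneous 0 := by
      have h := isHomogeneous_hasseDeriv hFd β
      rwa [Nat.sub_eq_zero_of_le (not_lt.1 hmd)] at h
    rw [eq_C_of_isHomogeneous_zero h0deg, ← MvPolynomial.algebraMap_eq]
    exact Subalgebra.algebraMap_mem U _
  -- `|β| < d`
  set m := β.degree with hm
  have hFedge : F ∈ edgeG (familySubalgebra O A) z hz := by rw [← hU]; exact hFU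
  obtain ⟨G, hG, hGF⟩ := EdgeCone.exists_lift_isHomogeneous F hFd
  have hx : MvPolynomial.eval z G ∈ maximalIdeal O ^ d := EdgeCone.eval_mem_pow_of_isHomogeneous z hz hG
  have hin : nu O (blMonomial d _ hx) ∈ edgeAlgebra (familySubalgebra O A) := by
    rw [← EdgeCone.blSubst_eq_blMonomial z hz hG hx, ← EdgeCone.polyMap_map_residue, hGF]
    exact hFedge
  obtain ⟨y, ⟨hyA, hym⟩, w, hw, hyw⟩ := Submodule.mem_sup.1 ((nu_blMonomial_mem_edgeAlgebra_iff A h0 hmul d hx).1 hin)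
  have hyP : Polynomial.monomial d y ∈ familySubalgebra O A :=
    (S04CharAlgebra.monomial_mem_familySubalgebra_iff A h0 hmul d y).2 hyA
  -- Diff-closedness applied to `Δ_β`
  have hD : Δ β ∈ diffOp K O m := leibnizFamily_mem_diffOp Δ hΔ0 hΔmul β
  have h1 : Δ β y ∈ A (d - m) :=
    (S04CharAlgebra.monomial_mem_familySubalgebra_iff A h0 hmul (d - m) (Δ β y)).1 (hdiff d m hmd (Δ β) hD y hyP)
  have h2 : Δ β y ∈ maximalIdeal O ^ (d - m) := leibnizFamily_apply_mem_pow_sub Δ hΔ0 hΔmul (maximalIdeal O) d β hym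
  -- the symbol congruence
  have hzP : ∀ i, MvPolynomial.aeval z (X i : MvPolynomial (Fin n) K) ∈ maximalIdeal O := fun i => by
    rw [MvPolynomial.aeval_X, ← hz]; exact Ideal.subset_span ⟨i, rfl⟩
  have hyshape : y = (∑ γ ∈ G.support, G.coeff γ * MvPolynomial.aeval z (monomial γ (1 : K))) + (-w) := by
    rw [← eval_eq_sum_mul_aeval_monomial (K := K) z G, ← hyw]; ring
  have hcongr := leibnizFamily_symbol_congr Δ (MvPolynomial.aeval z) (maximalIdeal O) hΔ0 hΔmul hΔext hzP
    G.support (fun γ hγ => degree_eq_of_mem_support hG hγ) (fun γ => G.coeff γ) (neg_mem hw) hmd.le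
  rw [← hyshape, ← eval_hasseDeriv_eq_sum (K := K) z β G] at hcongr
  -- the derivative of the lift
  have hG₂ : (hasseDeriv O β G).IsHomogeneous (d - m) := isHomogeneous_hasseDeriv hG β
  have hG₂F : MvPolynomial.map (residue O) (hasseDeriv O β G) = hasseDeriv (ResidueField O) β F := by
    rw [map_hasseDeriv, hGF]
  have hx₂ : MvPolynomial.eval z (hasseDeriv O β G) ∈ maximalIdeal O ^ (d - m) :=
    EdgeCone.eval_mem_pow_of_isHomogeneous z hz hG₂
  have hsub : Δ β y - MvPolynomial.eval z (hasseDeriv O β G) ∈ maximalIdeal O ^ (d - m + 1) := by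
    have e : d + 1 - m = d - m + 1 := by omega
    rw [← e]
    exact hcongr
  have hin₂ : nu O (blMonomial (d - m) _ hx₂) ∈ edgeAlgebra (familySubalgebra O A) := by
    rw [← EdgeCone.nu_blMonomial_eq_of_sub_mem h2 hx₂ hsub]
    exact (nu_blMonomial_mem_edgeAlgebra_iff A h0 hmul (d - m) h2).2 (Submodule.mem_sup_left ⟨h1, h2⟩)
  rw [← SetLike.mem_coe, hU, edgeG, Set.mem_preimage, ← hG₂F, EdgeCone.polyMap_map_residue,
    EdgeCone.blSubst_eq_blMonomial z hz hG₂ hx₂]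
  exact hin₂

include h0 hmul hΔ0 hΔmul hΔext hdiff in
/-- **[OURS · L1 W3.1] Hasse–Schmidt stability of the pulled-back edge algebra from stalkwise Diff-closedness and a
Leibniz family extending the Hasse derivatives** (local form of step (4) of the route `U19_3 ⇒ U19_4_R2`): for a local
`K`-algebra `(O, 𝔪, κ)`, a system `z` generating `𝔪`, a graded family `A` (`A 0 = ⊤`, `A_b A_c ⊆ A_{b+c}`) whose algebra
`⊕ A_d X^d` is Diff-closed stalkwise in the shape of the typed `U19_3` (`g X^d ∈ ⊕ A_d X^d`, `D ∈ Diff^{≤m}_{O/K}`, `m < d`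
⇒ `(Dg) X^{d−m} ∈ ⊕ A_d X^d`), and a Leibniz family `Δ` on `O` with `Δ_0 = id` extending the Hasse derivatives along
`aeval z`: the set `edgeG (⊕ A_d X^d) z ⊆ κ[Z]` is stable under every Hasse–Schmidt derivation `∂^{(β)}` of `κ[Z]`
(gradedness, p477733, reduces to the homogeneous case). NOT a statement of the manuscript. [folklore] -/
theorem hasseDeriv_mem_edgeG_of_leibnizFamily (β : Fin n →₀ ℕ) {F : MvPolynomial (Fin n) (ResidueField O)}
    (hF : F ∈ edgeG (familySubalgebra O A) z hz) :
    hasseDeriv (ResidueField O) β F ∈ edgeG (familySubalgebra O A) z hz := by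
  classical
  obtain ⟨U, hU⟩ := exists_subalgebra_coe_eq_edgeG z hz (familySubalgebra O A)
  have hUg : IsGradedSubalgebra U := isGradedSubalgebra_of_coe_eq_edgeG z hz A h0 hmul hU
  have hFU : F ∈ U := by rw [← SetLike.mem_coe, hU]; exact hF
  rw [← hU, SetLike.mem_coe, ← MvPolynomial.sum_homogeneousComponent F, map_sum]
  exact Subalgebra.sum_mem U fun e _ =>
    hasseDeriv_mem_of_isHomogeneous_of_leibnizFamily z hz A h0 hmul Δ hΔ0 hΔmul hΔext hdiff hU (hUg F hFU e)
      (MvPolynomial.homogeneousComponent_isHomogeneous e F) β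

end Local

end CampaignW31

open CampaignW31

/-! ## Scheme level: `U19_3` + Leibniz families at the closed singular points ⇒ `U19_4_R2` -/

section Sheaf

variable {K : Type u} [Field K] {Z : Scheme.{u}}

/-- **[OURS · L1 W3.1] step (4) of the route to `U19_4_R2`** (res-L1-s31-pv-1 ROUTE-NOTE 2026-08-27T00:33:22Z): the typed
candidate `U19_4_R2 p f E` (reading R2 of §4.1 (8) p.19 l.31–32: `edgeG (℘(E)_ξ) z` is stable under the Hasse–Schmidt
derivations of `κ(ξ)[Z]` at every closed singular point and every regular system of parameters) FOLLOWS from the typed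
candidate `U19_3 p f E` (stalkwise Diff-closedness of `℘(E)_ξ`, p.19 l.30–31 — landed modulo `Thm4_1` by the HIRONAKA-L
lane, `S04CharAlgebra.U19_3_of`) together with the EXISTENCE, at every closed `ξ ∈ Sing(E)` and for every r.s.p. `z`, of a
Leibniz family on `O_{Z,ξ}` with `Δ_0 = id` extending the Hasse derivatives along `aeval z : K[X] → O_{Z,ξ}` (step (2), in
progress at res-L1-s31-pv-1). Both inputs are HYPOTHESES here. NOT a statement of the manuscript. [folklore] -/
theorem U19_4_R2_of_U19_3_of_leibnizFamily (p : ℕ) [Fact p.Prime] [CharP K p] (f : Z ⟶ Spec (.of K))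
    (E : IdealExponent Z) (h3 : U19_3 p f E)
    (hΔ : ∀ ξ ∈ E.sing, ξ ∈ S02Preliminaries.closedPoints Z → ∀ (n : ℕ) (z : Fin n → Z.presheaf.stalk ξ),
      IsRSP (Z.presheaf.stalk ξ) z →
        letI := stalkAlgebra (kStructure f) ξ
        ∃ Δ : (Fin n →₀ ℕ) → (Z.presheaf.stalk ξ →ₗ[K] Z.presheaf.stalk ξ),
          Δ 0 = LinearMap.id ∧
          (∀ (β : Fin n →₀ ℕ) (x y : Z.presheaf.stalk ξ),
            Δ β (x * y) = ∑ q ∈ antidiagonal β, Δ q.1 x * Δ q.2 y) ∧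
          (∀ (β : Fin n →₀ ℕ) (F : MvPolynomial (Fin n) K),
            Δ β (MvPolynomial.aeval z F) = MvPolynomial.aeval z (hasseDeriv K β F))) :
    U19_4_R2 p f E := by
  intro hA hK hE ξ hξ hcl n z hz β F hF
  letI := stalkAlgebra (kStructure f) ξ
  haveI := hA.smooth
  haveI : IsLocallyNoetherian Z := LocallyOfFiniteType.isLocallyNoetherian f
  have hR : Scheme.IsRegular Z := Scheme.IsRegular.of_smooth f (Scheme.isRegular_Spec (.of K))
  obtain ⟨Δ, hΔ0, hΔmul, hΔext⟩ := hΔ ξ hξ hcl n z hz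
  have hdiff := h3 hA hK hE ξ hξ hcl
  exact hasseDeriv_mem_edgeG_of_leibnizFamily z hz.2.1 (fun d => stalkIdeal (pAlg E d) ξ) (stalkIdeal_pAlg_zero E ξ)
    (stalkIdeal_pAlg_mul_le hR E ξ) Δ hΔ0 hΔmul hΔext hdiff β hF

end Sheaf

/-! ## The slot statement modulo `U19_3` (or `Thm4_1`) and the existence of Leibniz families -/

/-- **[OURS · L1 W3.1] THE SLOT STATEMENT modulo `U19_3` + Leibniz families**: if for every perfect ambient datum the stalks
`℘(E)_ξ` are Diff-closed (typed candidate `U19_3`, HYPOTHESIS) and at every closed singular point every r.s.p. admits a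
Leibniz family on `O_{Z,ξ}` extending the Hasse derivatives (HYPOTHESIS; pure commutative algebra of the smooth local
ring — step (2) of the route), then `ξ ↦ Inv_ξ(E)` is upper semicontinuous on `Sing(E)_cl` for every standard `E` and every
selection of Def. 4.9 edge data (`CampaignW31UscInvOneExponentI p`; via `U19_4_R2_of_U19_3_of_leibnizFamily` and
`campaignW31UscInvOneExponentI_of_U19_4_R2`, p479154). NOT a statement of the manuscript. [folklore] -/
theorem campaignW31UscInvOneExponentI_of_U19_3_of_leibnizFamily (p : ℕ) [Fact p.Prime]
    (h3 : ∀ (K : Type u) [Field K] [CharP K p] [PerfectField K] (A : AmbientDatum p K) (E : IdealExponent A.Z),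
      U19_3 p A.hom E)
    (hΔ : ∀ (K : Type u) [Field K] [CharP K p] [PerfectField K] (A : AmbientDatum p K) (E : IdealExponent A.Z),
      ∀ ξ ∈ E.sing, ξ ∈ S02Preliminaries.closedPoints A.Z → ∀ (n : ℕ) (z : Fin n → A.Z.presheaf.stalk ξ),
        IsRSP (A.Z.presheaf.stalk ξ) z →
          letI := stalkAlgebra (kStructure A.hom) ξ
          ∃ Δ : (Fin n →₀ ℕ) → (A.Z.presheaf.stalk ξ →ₗ[K] A.Z.presheaf.stalk ξ),
            Δ 0 = LinearMap.id ∧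
            (∀ (β : Fin n →₀ ℕ) (x y : A.Z.presheaf.stalk ξ),
              Δ β (x * y) = ∑ q ∈ antidiagonal β, Δ q.1 x * Δ q.2 y) ∧
            (∀ (β : Fin n →₀ ℕ) (F : MvPolynomial (Fin n) K),
              Δ β (MvPolynomial.aeval z F) = MvPolynomial.aeval z (hasseDeriv K β F))) :
    CampaignW31UscInvOneExponentI.{u} p :=
  campaignW31UscInvOneExponentI_of_U19_4_R2 p fun K _ _ _ A E =>
    U19_4_R2_of_U19_3_of_leibnizFamily p A.hom E (h3 K A E) (hΔ K A E)

/-- **[OURS · L1 W3.1] THE SLOT STATEMENT modulo Th. 4.1 + Leibniz families**: the same with the typed candidate `Thm4_1`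
(Th. 4.1 p.17 l.20–30, an import from [23]; its clause (2) is the Diff-stability of `℘(E)`) in place of `U19_3`, through the
HIRONAKA-L lane's `S04CharAlgebra.U19_3_of : Thm4_1 p f E → U19_3 p f E` (U19L29). NOT a statement of the manuscript.
[folklore] -/
theorem campaignW31UscInvOneExponentI_of_Thm4_1_of_leibnizFamily (p : ℕ) [Fact p.Prime]
    (h41 : ∀ (K : Type u) [Field K] [CharP K p] [PerfectField K] (A : AmbientDatum p K) (E : IdealExponent A.Z),
      Thm4_1 p A.hom E)
    (hΔ : ∀ (K : Type u) [Field K] [CharP K p] [PerfectField K] (A : AmbientDatum p K) (E : IdealExponent A.Z),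
      ∀ ξ ∈ E.sing, ξ ∈ S02Preliminaries.closedPoints A.Z → ∀ (n : ℕ) (z : Fin n → A.Z.presheaf.stalk ξ),
        IsRSP (A.Z.presheaf.stalk ξ) z →
          letI := stalkAlgebra (kStructure A.hom) ξ
          ∃ Δ : (Fin n →₀ ℕ) → (A.Z.presheaf.stalk ξ →ₗ[K] A.Z.presheaf.stalk ξ),
            Δ 0 = LinearMap.id ∧
            (∀ (β : Fin n →₀ ℕ) (x y : A.Z.presheaf.stalk ξ),
              Δ β (x * y) = ∑ q ∈ antidiagonal β, Δ q.1 x * Δ q.2 y) ∧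
            (∀ (β : Fin n →₀ ℕ) (F : MvPolynomial (Fin n) K),
              Δ β (MvPolynomial.aeval z F) = MvPolynomial.aeval z (hasseDeriv K β F))) :
    CampaignW31UscInvOneExponentI.{u} p :=
  campaignW31UscInvOneExponentI_of_U19_3_of_leibnizFamily p (fun K _ _ _ A E => U19_3_of p A.hom E (h41 K A E)) hΔ

end Summit.ResolutionOfSingularities.ResolutionOfSingularities.Theorems

end
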